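import Mathlib
import HarnessLib

/-!
# S1a — R4c cusp, brick (b6-aux): the PRIME-IDEAL LEMMAS behind the `F`-locus containments and the Jacobian / unit certificates of the member charts

[OURS · L1 W4.5c · lead-1 g17; plan-1 RULING R-F15v (2) ★ R4c `cusp_killsIn_two`, SPEC `Cruxes/CyclicQuotientFourfolds/Lines/s1a_logminvertex-R4c-SPEC.md` §2:
on a producer chart of the level-1 root the new formal locus lies in the residual set `V(x₀-section) ∩ V(tail-section)` (✓`QhAbs.qha_residualSection_zero`,
✓`QhAbs.qha_residualSection_tail`), i.e. in primes `Q ∋ X₀′, φ` (`φ` the strict tail) not containing the chart's cover element. This file shows, by pure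
commutative algebra in any commutative ring, what such primes canNOT contain: at `O` (`φ = X₂′² − X₁′³`, chart `[N(x₁)]`): `X₂′`, the `τ′`-norm of `X₂′`, the
unit `h_O = 2X₂′ − 3sX₁′²` of the member row and its norm (uses `9a = 4`, i.e. the chart lies over `W_O = D(N(x₁ − a))`); on `[N(x₂)]`: `X₁′` and its norm (so
`F₁ ∩ [N(x₂)] ⊆ [N(x₁)]`); at `Q` (`T′` the recentred strict tail, chart `[N(y)]`): `π^*x₂ = c + sY′ + s²V′` (the Jacobian certificate of ✓`isRegular_away_X_cuspGraphQ`)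
and the unit `h_Q = 2(1 − 3a)Y′ + 2sV′ − 3sY′²`, with their norms] — NOT statements of the manuscript; counted 0; AI-level work, weaker than expert review.
Crux stmt-ResolutionOfSingularities-17941 `CyclicQuotientFourfolds`, line `s1a-logminvertex` v13 (`stub_reachLowerInFX`).
-/

set_option linter.dupNamespace false

noncomputable section

namespace Summit.ResolutionOfSingularities.ResolutionOfSingularities.Theorems.WildQuotientResolution.S1.Cusp

variable {A : Type} [CommRing A] (Q : Ideal A) [hQ : Q.IsPrime]

/-! ## Norm-type products modulo a prime -/

/-- A product `∏ₗ (x + cₗ·y)` with `y ∈ Q` lies in the prime `Q` iff `x ∈ Q` (index type `ZMod p`, `p ≠ 0`). [folklore] -/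
theorem prod_add_mul_mem_iff {p : ℕ} [NeZero p] (x y : A) (c : ZMod p → A) (hy : y ∈ Q) :
    (∏ l : ZMod p, (x + c l * y)) ∈ Q ↔ x ∈ Q := by
  classical
  constructor
  · intro h
    obtain ⟨l, -, hl⟩ := Ideal.IsPrime.prod_mem_iff.mp h
    have : x = (x + c l * y) - c l * y := by ring
    rw [this]
    exact Q.sub_mem hl (Q.mul_mem_left _ hy)
  · intro hx
    have h0 : x + c 0 * y ∈ Q := Q.add_mem hx (Q.mul_mem_left _ hy)
    exact Ideal.IsPrime.prod_mem_iff.mpr ⟨0, Finset.mem_univ _, h0⟩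

/-- A product of elements each congruent modulo `Q` to some `x ∉ Q` is `∉ Q`. [folklore] -/
theorem prod_not_mem_of_sub_mem {ι : Type} (S : Finset ι) (g : ι → A) (x : A) (hx : x ∉ Q) (hg : ∀ i ∈ S, g i - x ∈ Q) : (∏ i ∈ S, g i) ∉ Q := by
  classical
  intro h
  obtain ⟨i, hi, hiQ⟩ := Ideal.IsPrime.prod_mem_iff.mp h
  exact hx (by have := Q.sub_mem hiQ (hg i hi); rwa [sub_sub_cancel] at this)

/-- `4u³ − 9v·u⁴`-trick: from `h = 2X₂ − 3wX₁²` and `φ = X₂² − X₁³`, `X₁³(4 − 9w²X₁) = −4φ + h(2X₂ + 3wX₁²)`. -/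
theorem cusp_key_identity (w X₁ X₂ : A) : X₁ ^ 3 * (4 - 9 * w ^ 2 * X₁) = -4 * (X₂ ^ 2 - X₁ ^ 3) + (2 * X₂ - 3 * w * X₁ ^ 2) * (2 * X₂ + 3 * w * X₁ ^ 2) := by
  ring

/-! ## At `O`: the binomial `φ = X₂′² − X₁′³` -/

omit hQ in
/-- On `[N(x₁)]` (`N₁ = ∏ₗ(X₁′ + cₗ·X₀′) ∉ Q`): a prime `Q ∋ X₀′, φ` does not contain `X₂′` (so the Jacobian certificate `2X₂′` of
✓`FreeModel.isRegular_away_X_binomial23` holds and `F₁ ∩ [N(x₁)] ⊆ [N(x₂)]`). [OURS · L1 W4.5c · R4c] -/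
theorem cuspO_X₂_not_mem [hQ : Q.IsPrime] {p : ℕ} [NeZero p] (X₀ X₁ X₂ : A) (c : ZMod p → A) (hX₀ : X₀ ∈ Q) (hφ : X₂ ^ 2 - X₁ ^ 3 ∈ Q)
    (hN₁ : (∏ l : ZMod p, (X₁ + c l * X₀)) ∉ Q) : X₂ ∉ Q := by
  intro hX₂
  have hX₁3 : X₁ ^ 3 ∈ Q := by
    have : X₁ ^ 3 = X₂ ^ 2 - (X₂ ^ 2 - X₁ ^ 3) := by ring
    rw [this]; exact Q.sub_mem (by rw [pow_two]; exact Q.mul_mem_left _ hX₂) hφ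
  exact hN₁ ((prod_add_mul_mem_iff Q X₁ X₀ c hX₀).mpr (hQ.mem_of_pow_mem 3 hX₁3))

omit hQ in
/-- On `[N(x₂)]` (`X₂′ ∉ Q`): a prime `Q ∋ φ` does not contain `X₁′`, hence not `N₁ = ∏ₗ(X₁′ + cₗX₀′)` when `X₀′ ∈ Q`: `F₁ ∩ [N(x₂)] ⊆ [N(x₁)]`. [OURS · L1 W4.5c · R4c] -/
theorem cuspO_normX₁_not_mem [hQ : Q.IsPrime] {p : ℕ} [NeZero p] (X₀ X₁ X₂ : A) (c : ZMod p → A) (hX₀ : X₀ ∈ Q) (hφ : X₂ ^ 2 - X₁ ^ 3 ∈ Q) (hX₂ : X₂ ∉ Q) :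
    X₁ ∉ Q ∧ (∏ l : ZMod p, (X₁ + c l * X₀)) ∉ Q := by
  have hX₁ : X₁ ∉ Q := by
    intro hX₁
    have hX₂2 : X₂ ^ 2 ∈ Q := by
      have : X₂ ^ 2 = (X₂ ^ 2 - X₁ ^ 3) + X₁ ^ 2 * X₁ := by ring
      rw [this]; exact Q.add_mem hφ (Q.mul_mem_left _ hX₁)
    exact hX₂ (hQ.mem_of_pow_mem 2 hX₂2)
  exact ⟨hX₁, fun h => hX₁ ((prod_add_mul_mem_iff Q X₁ X₀ c hX₀).mp h)⟩

omit hQ in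
/-- ★ **The member-row unit at `O`**: on `[N(x₁)]` over `W_O = D(N(x₁ − a))` (`N₁ ∉ Q`, `H_O = ∏ₗ(s²X₁′ − a + cₗX₀′) ∉ Q`), with `9a = 4` and `9` a unit, a prime
`Q ∋ X₀′, φ` does not contain `h_O = 2X₂′ − 3sX₁′²` (the coefficient of `s⁶X₀′` in `(τ′ − 1)φ`). [OURS · L1 W4.5c · R4c] -/
theorem cuspO_hunit_not_mem [hQ : Q.IsPrime] {p : ℕ} [NeZero p] (s X₀ X₁ X₂ a : A) (c c' : ZMod p → A) (h9 : IsUnit (9 : A)) (h9a : 9 * a = 4)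
    (hX₀ : X₀ ∈ Q) (hφ : X₂ ^ 2 - X₁ ^ 3 ∈ Q) (hN₁ : (∏ l : ZMod p, (X₁ + c l * X₀)) ∉ Q) (hH : (∏ l : ZMod p, (s ^ 2 * X₁ - a + c' l * X₀)) ∉ Q) :
    (2 * X₂ - 3 * s * X₁ ^ 2) ∉ Q := by
  intro hh
  have hX₁ : X₁ ∉ Q := fun h => hN₁ ((prod_add_mul_mem_iff Q X₁ X₀ c hX₀).mpr h)
  have hprod : X₁ ^ 3 * (4 - 9 * s ^ 2 * X₁) ∈ Q := by
    rw [cusp_key_identity]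
    exact Q.add_mem (Q.mul_mem_left _ hφ) (Q.mul_mem_right _ hh)
  rcases hQ.mem_or_mem hprod with h3 | h4
  · exact hX₁ (hQ.mem_of_pow_mem 3 h3)
  · have h9' : (9 : A) * (a - s ^ 2 * X₁) ∈ Q := by
      have : (9 : A) * (a - s ^ 2 * X₁) = 4 - 9 * s ^ 2 * X₁ := by rw [← h9a]; ring
      rw [this]; exact h4
    rcases hQ.mem_or_mem h9' with h9Q | haQ
    · exact hQ.ne_top (Q.eq_top_of_isUnit_mem h9Q h9)
    · refine hH ((prod_add_mul_mem_iff Q (s ^ 2 * X₁ - a) X₀ c' hX₀).mpr ?_)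
      have : s ^ 2 * X₁ - a = -(a - s ^ 2 * X₁) := by ring
      rw [this]; exact Q.neg_mem haQ

omit hQ in
/-- The `τ′`-NORM of `X₂′` (`∏ₗ(X₂′ + cₗ·X₀′)`) and of `h_O` (`∏ₗ(2(X₂′ + cₗX₀′) − 3s(X₁′ + c′ₗX₀′)²)`) are `∉ Q` as soon as `X₂′ ∉ Q`, resp. `h_O ∉ Q`, and
`X₀′ ∈ Q` (each factor is congruent to the base). [OURS · L1 W4.5c · R4c] -/
theorem cuspO_norms_not_mem [hQ : Q.IsPrime] {p : ℕ} [NeZero p] (s X₀ X₁ X₂ : A) (c c' : ZMod p → A) (hX₀ : X₀ ∈ Q) :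
    (X₂ ∉ Q → (∏ l : ZMod p, (X₂ + c l * X₀)) ∉ Q) ∧
      ((2 * X₂ - 3 * s * X₁ ^ 2) ∉ Q → (∏ l : ZMod p, (2 * (X₂ + c l * X₀) - 3 * s * (X₁ + c' l * X₀) ^ 2)) ∉ Q) := by
  refine ⟨fun hX₂ => prod_not_mem_of_sub_mem Q _ _ _ hX₂ fun l _ => ?_, fun hh => prod_not_mem_of_sub_mem Q _ _ _ hh fun l _ => ?_⟩
  · have : X₂ + c l * X₀ - X₂ = c l * X₀ := by ring
    rw [this]; exact Q.mul_mem_left _ hX₀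
  · have : 2 * (X₂ + c l * X₀) - 3 * s * (X₁ + c' l * X₀) ^ 2 - (2 * X₂ - 3 * s * X₁ ^ 2) = (2 * c l - 3 * s * (2 * X₁ * c' l + c' l ^ 2 * X₀)) * X₀ := by ring
    rw [this]; exact Q.mul_mem_left _ hX₀

/-! ## At `Q`: the recentred strict tail `T′ = s²V′² + 2sV′Y′ + 2c·V′ + (1 − 3a)Y′² − sY′³` -/

/-- The chart identity at `Q`: `s²T′ = (π^*x₂)² − (π^*x₁)³` with `π^*x₂ = c + sY′ + s²V′`, `π^*x₁ = sY′ + a` (uses `c² = a³`, `2c = 3a²`). -/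
theorem cuspQ_chart_identity (s Y V a c : A) (h2c : 2 * c = 3 * a ^ 2) (hc2 : c ^ 2 = a ^ 3) :
    s ^ 2 * (s ^ 2 * V ^ 2 + 2 * s * V * Y + 2 * c * V + (1 - 3 * a) * Y ^ 2 - s * Y ^ 3) = (c + s * Y + s ^ 2 * V) ^ 2 - (s * Y + a) ^ 3 := by
  linear_combination (-1 : A) * hc2 - s * Y * h2c

omit hQ in
/-- ★ **The Jacobian certificate at `Q`**: on `[N(y)]` over `W_Q = D(N(x₁))` (`H_Q = ∏ₗ(sY′ + a + cₗX₀′) ∉ Q`), a prime `Q ∋ X₀′, T′` does not contain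
`π^*x₂ = c + sY′ + s²V′` (hypothesis `hD` of ✓`FreeModel.isRegular_away_X_cuspGraphQ`), nor its norm. [OURS · L1 W4.5c · R4c] -/
theorem cuspQ_x₂_not_mem [hQ : Q.IsPrime] {p : ℕ} [NeZero p] (s X₀ Y V a c : A) (cc cc' : ZMod p → A) (h2c : 2 * c = 3 * a ^ 2) (hc2 : c ^ 2 = a ^ 3)
    (hX₀ : X₀ ∈ Q) (hT : s ^ 2 * V ^ 2 + 2 * s * V * Y + 2 * c * V + (1 - 3 * a) * Y ^ 2 - s * Y ^ 3 ∈ Q) (hH : (∏ l : ZMod p, (s * Y + a + cc l * X₀)) ∉ Q) :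
    (c + s * Y + s ^ 2 * V) ∉ Q ∧ (∏ l : ZMod p, (c + s * (Y + cc' l * X₀) + s ^ 2 * V)) ∉ Q := by
  have hx₂ : (c + s * Y + s ^ 2 * V) ∉ Q := by
    intro hx
    have h3 : (s * Y + a) ^ 3 ∈ Q := by
      have : (s * Y + a) ^ 3 = (c + s * Y + s ^ 2 * V) ^ 2 - s ^ 2 * (s ^ 2 * V ^ 2 + 2 * s * V * Y + 2 * c * V + (1 - 3 * a) * Y ^ 2 - s * Y ^ 3) := by
        rw [cuspQ_chart_identity s Y V a c h2c hc2]; ring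
      rw [this]; exact Q.sub_mem (by rw [pow_two]; exact Q.mul_mem_left _ hx) (Q.mul_mem_left _ hT)
    exact hH ((prod_add_mul_mem_iff Q (s * Y + a) X₀ cc hX₀).mpr (hQ.mem_of_pow_mem 3 h3))
  refine ⟨hx₂, prod_not_mem_of_sub_mem Q _ _ _ hx₂ fun l _ => ?_⟩
  have : c + s * (Y + cc' l * X₀) + s ^ 2 * V - (c + s * Y + s ^ 2 * V) = s * cc' l * X₀ := by ring
  rw [this]; exact Q.mul_mem_left _ hX₀

omit hQ in
/-- ★ **The member-row unit at `Q`**: on `[N(y)]` (`N_Y = ∏ₗ(Y′ + cₗ·X₀′) ∉ Q`) over `W_Q` (`H_Q ∉ Q`), with `9a = 4`, `2c = 3a²`, `c² = a³` and `2, 9` units, a prime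
`Q ∋ X₀′, T′` does not contain `h_Q = 2(1 − 3a)Y′ + 2sV′ − 3sY′²` (`s·h_Q = π^*(2x₂ − 3x₁²)`), nor its norm. [OURS · L1 W4.5c · R4c] -/
theorem cuspQ_hunit_not_mem [hQ : Q.IsPrime] {p : ℕ} [NeZero p] (s X₀ Y V a c : A) (cc ccY cc' : ZMod p → A) (h2 : IsUnit (2 : A)) (h9 : IsUnit (9 : A))
    (h9a : 9 * a = 4) (h2c : 2 * c = 3 * a ^ 2) (hc2 : c ^ 2 = a ^ 3)
    (hX₀ : X₀ ∈ Q) (hT : s ^ 2 * V ^ 2 + 2 * s * V * Y + 2 * c * V + (1 - 3 * a) * Y ^ 2 - s * Y ^ 3 ∈ Q)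
    (hH : (∏ l : ZMod p, (s * Y + a + cc l * X₀)) ∉ Q) (hNY : (∏ l : ZMod p, (Y + ccY l * X₀)) ∉ Q) :
    (2 * (1 - 3 * a) * Y + 2 * s * V - 3 * s * Y ^ 2) ∉ Q ∧
      (∏ l : ZMod p, (2 * (1 - 3 * a) * (Y + cc' l * X₀) + 2 * s * V - 3 * s * (Y + cc' l * X₀) ^ 2)) ∉ Q := by
  have hY : Y ∉ Q := fun h => hNY ((prod_add_mul_mem_iff Q Y X₀ ccY hX₀).mpr h)
  have hx₁ : (s * Y + a) ∉ Q := fun h => hH ((prod_add_mul_mem_iff Q (s * Y + a) X₀ cc hX₀).mpr h)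
  have h13a : (1 - 3 * a) * (-3 : A) = 1 := by linear_combination h9a
  have hunit13 : IsUnit (1 - 3 * a : A) := IsUnit.of_mul_eq_one _ h13a
  have hQ' : (2 * (1 - 3 * a) * Y + 2 * s * V - 3 * s * Y ^ 2) ∉ Q := by
    intro hh
    -- `s·h_Q = 2x₂ − 3x₁²` with `x₁ = sY + a`, `x₂ = c + sY + s²V`; `x₂² − x₁³ = s²T′ ∈ Q`
    have hsh : 2 * (c + s * Y + s ^ 2 * V) - 3 * 1 * (s * Y + a) ^ 2 ∈ Q := by
      have : 2 * (c + s * Y + s ^ 2 * V) - 3 * 1 * (s * Y + a) ^ 2 = s * (2 * (1 - 3 * a) * Y + 2 * s * V - 3 * s * Y ^ 2) := by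
        linear_combination h2c
      rw [this]; exact Q.mul_mem_left _ hh
    have hφ : (c + s * Y + s ^ 2 * V) ^ 2 - (s * Y + a) ^ 3 ∈ Q := by
      rw [← cuspQ_chart_identity s Y V a c h2c hc2]; exact Q.mul_mem_left _ hT
    have hprod : (s * Y + a) ^ 3 * (4 - 9 * 1 ^ 2 * (s * Y + a)) ∈ Q := by
      rw [cusp_key_identity]
      exact Q.add_mem (Q.mul_mem_left _ hφ) (Q.mul_mem_right _ hsh)
    rcases hQ.mem_or_mem hprod with h3 | h4
    · exact hx₁ (hQ.mem_of_pow_mem 3 h3)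
    · have hsY : (9 : A) * (s * Y) ∈ Q := by
        have : (9 : A) * (s * Y) = -(4 - 9 * 1 ^ 2 * (s * Y + a)) := by linear_combination -h9a
        rw [this]; exact Q.neg_mem h4
      rcases hQ.mem_or_mem hsY with h9Q | hsY'
      · exact hQ.ne_top (Q.eq_top_of_isUnit_mem h9Q h9)
      rcases hQ.mem_or_mem hsY' with hs | hY'
      · -- on `E`: `h_Q ≡ 2(1 − 3a)Y′`
        have h2Y : 2 * (1 - 3 * a) * Y ∈ Q := by
          have : 2 * (1 - 3 * a) * Y = (2 * (1 - 3 * a) * Y + 2 * s * V - 3 * s * Y ^ 2) - s * (2 * V - 3 * Y ^ 2) := by ring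
          rw [this]; exact Q.sub_mem hh (Q.mul_mem_right _ hs)
        rcases hQ.mem_or_mem h2Y with h2a | hY''
        · rcases hQ.mem_or_mem h2a with h2Q | h13
          · exact hQ.ne_top (Q.eq_top_of_isUnit_mem h2Q h2)
          · exact hQ.ne_top (Q.eq_top_of_isUnit_mem h13 hunit13)
        · exact hY hY''
      · exact hY hY'
  refine ⟨hQ', prod_not_mem_of_sub_mem Q _ _ _ hQ' fun l _ => ?_⟩
  have : 2 * (1 - 3 * a) * (Y + cc' l * X₀) + 2 * s * V - 3 * s * (Y + cc' l * X₀) ^ 2 - (2 * (1 - 3 * a) * Y + 2 * s * V - 3 * s * Y ^ 2) =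
      (2 * (1 - 3 * a) * cc' l - 3 * s * (2 * Y * cc' l + cc' l ^ 2 * X₀)) * X₀ := by ring
  rw [this]; exact Q.mul_mem_left _ hX₀

end Summit.ResolutionOfSingularities.ResolutionOfSingularities.Theorems.WildQuotientResolution.S1.Cusp

end
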